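import Literature.NumberTheory.EllipticCurves.PAdicLFunctionQuadraticTwistCongruenceAtTwoProofs
import Literature.NumberTheory.EllipticCurves.PAdicLFunctionQuadraticTwistBirchPeriodProofs
import Literature.NumberTheory.EllipticCurves.PAdicLFunctionTameMultCongruenceAtTwoProofs
import HarnessLib

/-!
# The mod-`2` twist congruence at a GOOD ORDINARY `2` WITH THE PERIOD SIZE OF BIRCH'S CONSTANT
# (Matsuno 2000, proof of Thm. 3.1 read at `p = 2`; Mazur–Tate–Teitelbaum §I.8), PROOFS ONLY

A *proofs* file (theorems only: no definition, no named fact, no axiom). It is the good-ordinary twin of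
`exists_iwasawa_twist_congr_two_mult` (`PAdicLFunctionTameMultCongruenceAtTwoProofs`, multiplicative `2`) and the
period-keeping refinement of `exists_iwasawa_twist_congr_two` (`PAdicLFunctionQuadraticTwistCongruenceAtTwoProofs`):
for `E = W/ℚ` globally minimal and good ordinary at `2`, `d > 0`, `d ≡ 1 (mod 4)` squarefree and prime to `N_E`, `A` a model
of `E^{(d)}`, newforms `f_W`, `f_A`, and `S₀` the places over the primes of `d`:

* `exists_padicLFunction_twist_eq_C_mul_padicLFunctionTame_and_sq` — Birch's lemma for the `2`-adic (indeed `p`-adic)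
  `L`-functions, `L_p(f_A, α_A) = C(c)·(1+T)^{−f_m}·L_p(f_W, m, α_W, χ_d)`, TOGETHER WITH `c ≠ 0` and the period identity
  `c² · d · (Ω⁺_{f_A})² = (Ω⁺_{f_W})²` (the symbol-level `exists_ratPlusSymbol_twist_eq_sum_and_sq`; the non-vanishing of
  some plus symbol of `f_A`, `exists_ratPlusSymbol_ne_zero`, makes the period clause unconditional);
* **`exists_iwasawa_twist_congr_two_and_sq`** — there are `L_W, L_A' ∈ Λ = ℤ₂⟦T⟧`, `c_A ∈ ℚˣ`, `v ∈ Λˣ` with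
  `ι L_W = L₂(f_W, α_W)`, `ι L_A' = C(c_A)·L₂(f_A, α_A)`, `L_A' ≡ v · L_W · ∏_{v∈S₀} 𝒫_v (mod 2Λ)` AND
  `d · (Ω⁺_{f_A})² = c_A² · (Ω⁺_{f_W})²`.

The period clause is what lets the analytic `μ = 0` certificate DESCEND from the twist to the anchor in the Néron
normalisation (Summits side, `Theorems/TwoAdicConverseLambdaHalfTwistDescent.lean`): with V. Pal's `√d·Ω(A) = Ω(W)` it gives
`|ϖ_A| = |c_A·ϖ_W|` for the Néron ratios `ϖ·Ω = Ω⁺_f`. Everything is proved; nothing is asserted; normalisations are the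
tree's (`Ω⁺ = plusPeriod`, all real components).

## References

* K. Matsuno, J. Number Theory 84 (2000) 80–92, Lemmas 3.2–3.3 and proof of Thm. 3.1 (pp. 86–88). [Matsuno2000]
* B. Mazur, J. Tate, J. Teitelbaum, Invent. Math. 84 (1986), §I.8, §I.11–I.13. [MazurTateTeitelbaum1986Invent]
* G. Shimura, *Introduction to the arithmetic theory of automorphic functions* (1971), Prop. 3.64. [Shimura1971]
-/

noncomputable section

open scoped MatrixGroups ModularForm NumberTheorySymbols

open CongruenceSubgroup NumberField IsDedekindDomain WeierstrassCurve PowerSeries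
  Literature.NumberTheory.EllipticCurves.ModularForms Literature.NumberTheory.EllipticCurves.GreenbergVatsal2000

namespace Literature.NumberTheory.EllipticCurves

/-! ## §1. Birch's lemma for the transforms WITH the period identity -/

section Transform

variable (W : WeierstrassCurve ℚ) [W.IsElliptic] [W.IsGloballyMinimal] {d : ℤ} {A : WeierstrassCurve ℚ}
  [A.IsElliptic] [A.IsGloballyMinimal] {p : ℕ} [Fact p.Prime]
  [NeZero (W.conductorNorm ℤ)] [NeZero (A.conductorNorm ℤ)] [NeZero d.natAbs]
  {fW : CuspForm (Gamma0 (W.conductorNorm ℤ)) 2} {fA : CuspForm (Gamma0 (A.conductorNorm ℤ)) 2}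

/-- **Birch's lemma for the `p`-adic `L`-function of the quadratic twist, WITH the period size of the constant** (`p` a good
ordinary prime of `E`, `p ∤ d`; `d > 0`, `d ≡ 1 (mod 4)` squarefree, `(d, N_E) = 1`; `m = d`, `χ_d = (· / m)`): for some
`c ∈ ℚˣ`, `L_p(f_A, α_A, T) = C(c) · (1+T)^{−f_m} · L_p(f_W, m, α_W, χ_d, T)` in `ℚ_p⟦T⟧` AND `c² · d · (Ω⁺_{f_A})² = (Ω⁺_{f_W})²`.
The proof of `exists_padicLFunction_twist_eq_C_mul_padicLFunctionTame` verbatim with the symbol relation taken from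
`exists_ratPlusSymbol_twist_eq_sum_and_sq`; the period clause is unconditional because `f_A` has a nonzero plus symbol
(`exists_ratPlusSymbol_ne_zero`), which also gives `c ≠ 0` without Rohrlich.
[cite: MazurTateTeitelbaum1986Invent, §I.8 and §I.11–I.13] [cite: Shimura1971, Prop. 3.64] [cite: Matsuno2000, §2 (p. 84)] -/
theorem exists_padicLFunction_twist_eq_C_mul_padicLFunctionTame_and_sq (hmod : exists_isNewformOf) (hd : 0 < d)
    (hd4 : d % 4 = 1) (hsq : Squarefree d) (hcop : IsCoprime d (W.conductorNorm ℤ : ℤ)) {C : VariableChange ℚ}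
    (hA : C • W.quadraticTwist (d : ℚ) = A) (hfW : IsNewformOf W fW) (hfA : IsNewformOf A fA)
    (hord : IsOrdinaryAt W p) (hpd : ¬ (p : ℤ) ∣ d)
    {χ : MulChar (ZMod d.natAbs) ℤ} (hχ : ∀ a : ZMod d.natAbs, χ a = J((a.val : ℤ) | d.natAbs)) :
    ∃ c : ℚ, c ≠ 0 ∧ padicLFunction fA (unitRoot A p : ℚ_[p]) =
      PowerSeries.C (c : ℚ_[p]) * PowerSeries.binomialSeries ℚ_[p] (-frobeniusExponent p (d.natAbs : ℤ_[p])) *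
        padicLFunctionTame fW d.natAbs (unitRoot W p : ℚ_[p])
          ((χ.ringHomComp (Int.castRingHom ℚ)).ringHomComp (Rat.castHom ℚ_[p])) ∧
      (c : ℝ) ^ 2 * (d : ℝ) * plusPeriod fA ^ 2 = plusPeriod fW ^ 2 := by
  have hp : p.Prime := Fact.out
  obtain ⟨c, hB, hper⟩ := exists_ratPlusSymbol_twist_eq_sum_and_sq W hmod hd hd4 hsq hcop hA hfW hfA hχ
  have hxA : ∃ x : ℚ, ratPlusSymbol fA x ≠ 0 := exists_ratPlusSymbol_ne_zero hfA.1 hfA.coeffField_eq_bot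
  have hc0 : c ≠ 0 := by
    rintro rfl
    obtain ⟨x, hx⟩ := hxA
    exact hx (by rw [hB x, zero_mul])
  obtain ⟨hordA, hαA⟩ := isOrdinaryAt_twist_and_unitRoot_eq W p hmod hd4 hsq hcop hA hord hpd
  obtain ⟨hαeq, hαu, -⟩ := unitRoot_coe_spec (W := W) hord
  have hpN : ¬ p ∣ W.conductorNorm ℤ := not_dvd_level_of_isNewformOf hfW hord.1
  have hpm : ¬ p ∣ d.natAbs := fun h ↦ hpd (Int.natCast_dvd.mpr h)
  have hmp : d.natAbs.Coprime p := Nat.coprime_comm.mp ((Nat.Prime.coprime_iff_not_dvd hp).mpr hpm)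
  have hap : cuspCoeff fW p = ((W.frobeniusTrace p : ℤ) : ℂ) :=
    cuspCoeff_eq_frobeniusTrace_of_isNewformOf_holds hfW hord.1
  have hχp : (χ.ringHomComp (Int.castRingHom ℚ)) (p : ZMod d.natAbs) ^ 2 = 1 := by
    rw [MulChar.ringHomComp_apply, ← map_pow, mulChar_jacobi_apply_natCast_sq hχ p hmp.symm, map_one]
  have key := padicLFunction_twist_eq_of_birch fW fA hfW.1 hfW.coeffField_eq_bot hpN hmp hap hαeq hαu
    (χ.ringHomComp (Int.castRingHom ℚ)) hχp hB
  have hαA' : (unitRoot A p : ℚ_[p]) =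
      (((χ.ringHomComp (Int.castRingHom ℚ)) (p : ZMod d.natAbs) : ℚ) : ℚ_[p]) * (unitRoot W p : ℚ_[p]) := by
    rw [hαA, MulChar.ringHomComp_apply, mulChar_jacobi_apply_natCast hχ p, eq_intCast]
    push_cast
    rfl
  exact ⟨c, hc0, by rw [hαA']; exact key, hper hxA⟩

end Transform

/-! ## §2. The mod-`2` twist congruence WITH the period size of `c_A` -/

section TwoAdic

variable (W : WeierstrassCurve ℚ) [W.IsElliptic] [W.IsGloballyMinimal] {d : ℤ} {A : WeierstrassCurve ℚ}
  [A.IsElliptic] [A.IsGloballyMinimal]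
  [NeZero (W.conductorNorm ℤ)] [NeZero (A.conductorNorm ℤ)]
  {fW : CuspForm (Gamma0 (W.conductorNorm ℤ)) 2} {fA : CuspForm (Gamma0 (A.conductorNorm ℤ)) 2}

omit [W.IsElliptic] [W.IsGloballyMinimal] [NeZero (W.conductorNorm ℤ)] in
/-- Distinct finite places of `ℚ` lie over distinct primes; private helper. [folklore] -/
private theorem natGenerator_injective_rat'' :
    Function.Injective (Rat.HeightOneSpectrum.natGenerator (R := 𝓞 ℚ)) := fun _ _ h ↦
  (Rat.HeightOneSpectrum.primesEquiv (R := 𝓞 ℚ)).injective (Subtype.ext h)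

/-- **The mod-`2` twist congruence at a good ordinary `2`, WITH the period size of the constant** (Matsuno 2000, proof
of Thm. 3.1 = Lemmas 3.2 + 3.3, READ AT `p = 2`, with Birch's lemma and its period identity): for `E = W/ℚ` globally minimal,
good ordinary at `2` (NO hypothesis on `E[2]`), `d > 0`, `d ≡ 1 (mod 4)` squarefree and prime to `N_E`, `A` a globally minimal
model of `E^{(d)}`, newforms `f_W`, `f_A`, and `S₀` the set of places over the primes dividing `d`: there are
`L_W, L_A' ∈ Λ = ℤ₂⟦T⟧`, `c_A ∈ ℚˣ` and `v ∈ Λˣ` with `ι L_W = L₂(f_W, α_W)`, `ι L_A' = C(c_A)·L₂(f_A, α_A)`,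
`L_A' ≡ v · L_W · ∏_{v∈S₀} 𝒫_v (mod 2Λ)` (`𝒫_v` = Greenberg–Vatsal's Euler factor), AND `d · (Ω⁺_{f_A})² = c_A² · (Ω⁺_{f_W})²`
(`c_A = c⁻¹` for Birch's `c` with `c²·d·(Ω⁺_{f_A})² = (Ω⁺_{f_W})²`). The proof of `exists_iwasawa_twist_congr_two` verbatim,
fed with §1. [cite: Matsuno2000, Lemmas 3.2–3.3 and proof of Theorem 3.1 (pp. 86–88)] [cite: MazurTateTeitelbaum1986Invent, §I.8] -/
theorem exists_iwasawa_twist_congr_two_and_sq (hmod : exists_isNewformOf) (hd : 0 < d) (hd4 : d % 4 = 1)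
    (hsq : Squarefree d) (hcop : IsCoprime d (W.conductorNorm ℤ : ℤ)) {C : VariableChange ℚ}
    (hA : C • W.quadraticTwist (d : ℚ) = A) (hfW : IsNewformOf W fW) (hfA : IsNewformOf A fA)
    (hord : IsOrdinaryAt W 2) (S₀ : Finset (HeightOneSpectrum (𝓞 ℚ)))
    (hS₀ : S₀.image Rat.HeightOneSpectrum.natGenerator = d.natAbs.primeFactors) :
    ∃ (LW LA' : IwasawaAlgebra 2) (cA : ℚ) (v : (IwasawaAlgebra 2)ˣ),
      iwasawaToPowerSeries 2 LW = padicLFunction fW (unitRoot W 2 : ℚ_[2]) ∧ cA ≠ 0 ∧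
      iwasawaToPowerSeries 2 LA' = PowerSeries.C (cA : ℚ_[2]) * padicLFunction fA (unitRoot A 2 : ℚ_[2]) ∧
      PowerSeries.map (PadicInt.toZMod (p := 2)) LA' =
        PowerSeries.map (PadicInt.toZMod (p := 2)) ((v : IwasawaAlgebra 2) * LW * eulerFactorProduct W 2 S₀) ∧
      (d : ℝ) * plusPeriod fA ^ 2 = (cA : ℝ) ^ 2 * plusPeriod fW ^ 2 := by
  have hd0 : d ≠ 0 := hd.ne'
  haveI : NeZero d.natAbs := ⟨Int.natAbs_ne_zero.mpr hd0⟩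
  have hsq' : Squarefree d.natAbs := Int.squarefree_natAbs.mpr hsq
  have hm4 : d.natAbs % 4 = 1 := by omega
  have hd2 : ¬ (2 : ℤ) ∣ d := by omega
  obtain ⟨χ, hχ⟩ := exists_mulChar_int_eq_jacobiSym d.natAbs
  obtain ⟨c, hc0, hL, hper⟩ :=
    exists_padicLFunction_twist_eq_C_mul_padicLFunctionTame_and_sq W hmod hd hd4 hsq hcop hA hfW hfA hord hd2 hχ
  set χ₂ : DirichletCharacter ℚ_[2] d.natAbs :=
    (χ.ringHomComp (Int.castRingHom ℚ)).ringHomComp (Rat.castHom ℚ_[2]) with hχ₂_def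
  have hχ₂even : χ₂.Even := by
    show χ₂ (-1) = 1
    rw [hχ₂_def, MulChar.ringHomComp_apply, MulChar.ringHomComp_apply, mulChar_jacobi_apply_neg_one hχ hm4, map_one,
      map_one]
  have hχ₂sq : χ₂ ^ 2 = 1 := by
    have : χ₂ = χ.ringHomComp ((Rat.castHom ℚ_[2]).comp (Int.castRingHom ℚ)) := MulChar.ext' fun a ↦ rfl
    rw [this]
    exact mulChar_jacobi_ringHomComp_sq hχ _
  -- the places over the primes of `d`
  have hS2 : ∀ v ∈ S₀, Rat.HeightOneSpectrum.natGenerator v ≠ 2 := by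
    intro v hv h
    have hmem : Rat.HeightOneSpectrum.natGenerator v ∈ d.natAbs.primeFactors := hS₀ ▸ Finset.mem_image_of_mem _ hv
    rw [h] at hmem
    exact hd2 (Int.natCast_dvd.mpr (Nat.dvd_of_mem_primeFactors hmem))
  have hgood : ∀ v ∈ S₀, W.HasGoodReductionAt v := by
    intro v hv
    refine hasGoodReductionAt_of_not_dvd_conductorNorm W v fun hvN ↦ ?_
    have hmem : Rat.HeightOneSpectrum.natGenerator v ∈ d.natAbs.primeFactors := hS₀ ▸ Finset.mem_image_of_mem _ hv
    have hℓ : (Rat.HeightOneSpectrum.natGenerator v).Prime := Nat.prime_of_mem_primeFactors hmem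
    have hℓd : (Rat.HeightOneSpectrum.natGenerator v : ℤ) ∣ d := Int.natCast_dvd.mpr (Nat.dvd_of_mem_primeFactors hmem)
    have hu := Int.isUnit_iff_natAbs_eq.mp
      (hcop.isUnit_of_dvd' hℓd (Int.natCast_dvd_natCast.mpr hvN))
    rw [Int.natAbs_natCast] at hu
    exact hℓ.one_lt.ne' hu
  have hm : d.natAbs = ∏ v ∈ S₀, Rat.HeightOneSpectrum.natGenerator v := by
    have h := Nat.prod_primeFactors_of_squarefree hsq'
    rw [← hS₀, Finset.prod_image fun v _ w _ h ↦ natGenerator_injective_rat'' h] at h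
    exact h.symm
  obtain ⟨LW, G, u, hLW, hG, hGc⟩ :=
    exists_iwasawa_padicLFunctionTame_congr_two_auto hord hfW S₀ hS2 hgood hm χ₂ hχ₂even hχ₂sq
  -- the unit `(1+T)^{−f_m}` of `Λ`
  set B : IwasawaAlgebra 2 := PowerSeries.binomialSeries ℤ_[2] (-frobeniusExponent 2 (d.natAbs : ℤ_[2])) with hB
  have hBu : IsUnit B :=
    isUnit_iff_exists_inv.mpr ⟨PowerSeries.binomialSeries ℤ_[2] (frobeniusExponent 2 (d.natAbs : ℤ_[2])), by
      rw [hB, ← PowerSeries.binomialSeries_add, neg_add_cancel, PowerSeries.binomialSeries_zero]⟩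
  have hcQ : (c : ℚ_[2]) ≠ 0 := by exact_mod_cast hc0
  have hperiod : (d : ℝ) * plusPeriod fA ^ 2 = ((c⁻¹ : ℚ) : ℝ) ^ 2 * plusPeriod fW ^ 2 := by
    have hcR : (c : ℝ) ≠ 0 := by exact_mod_cast hc0
    rw [← hper]
    push_cast
    field_simp
  refine ⟨LW, B * G, c⁻¹, hBu.unit * u, hLW, inv_ne_zero hc0, ?_, ?_, hperiod⟩
  · rw [map_mul, hG, hB, BurungaleSkinner2023.iwasawaToPowerSeries_binomialSeries, hL, Rat.cast_inv, ← mul_assoc,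
      ← mul_assoc, ← map_mul, inv_mul_cancel₀ hcQ, map_one, one_mul]
  · rw [map_mul, hGc, ← map_mul, Units.val_mul, IsUnit.unit_spec]
    congr 1
    ring

end TwoAdic

end Literature.NumberTheory.EllipticCurves

end
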